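import Summits.QuantumFields.YangMills.Theorems.UnitScaleTiltProp7SymFrameCovDefs
import Literature.MathematicalPhysics.QuantumFieldTheory.Balaban1983to89.B15DeterminingSets
import HarnessLib

/-!
# Route `UnitScaleTilt`, crux K1 child «MinimiserStabilityRegPr» (stmt-QuantumFields-19200), skeleton v10, stub `stub_existenceMinimalOrbit` (EX), route (α) — **THE FIRST-ORDER RESPONSE
# OF THE SYMMETRIC COVARIANT BLOCK FRAME TO A GAUGE DIRECTION, AT THE BACKGROUND** (brick FR₀ of the `hXtw‴`(iii) transport, LOCATE memo `LOCATE-TRANSPORT-LIN-w5g6.md` §2–§3 (19200 evidence);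
# one level, any complete normed `ℂ`-algebra).

Cell `ym3-torus`, width seat `ym-ust-20520-w5` (gen 6).  THEOREMS ONLY (0 `def`, 0 `sorry`).  `--supports stmt-QuantumFields-19200 --as helper`, count-neutral.  YM₃ on T³ is a ladder rung (R3), not
the Clay problem; nothing here claims the stub, the crux, d = 4 or the mass gap.

THE POINT.  The `hsplit` half of the `hXtw‴`(iii) junction needs the response of the symmetric frames `w_sym(U₀; W)(y) = eml_i[W(Γ_{y,i})·U₀(Γ_{y,i})⁻¹]` (✓`Prop7SymAvgTwSym.vframeCovU`, [Balaban1985Averaging] (82))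
to a GAUGE DIRECTION of `W` with the background `U₀` FIXED (memo (R-𝓚)/(TRANS)).  Since a gauge transformation of `W` alone enters the stair transporters in the middle
(`g(ŷ)·W(Γ)·g(x_i)⁻¹·U₀(Γ)⁻¹`, ✓`tstairU_def`), the frames are not covariant; but AT THE BACKGROUND (`W = U₀`, all transporters `= 1`, `D(eml)(1) =` arithmetic mean ✓`hasFDerivAt_eml_one`) the
response is explicit: **`d∕dt|₀ w_sym(U₀; U₀^{exp(tN)})(y) = |I|⁻¹ Σ_i (N(ŷ) − U₀(Γ_{y,i})·N(x_i)·U₀(Γ_{y,i})⁻¹)`** — the gauge parameter at the centre minus the mean of its parallel transports from the stair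
end-points.  This is the first rung of the operator `𝓚 : N ↦ N|_{x̂} − (frame response)` of the memo (here `𝓚₀N(y) = mean_i Ad_{U₀(Γ_{y,i})}N(x_i)`).

WHAT IS PROVED (sorry-free, no definition; level `j`, `𝔸` any complete normed `ℂ`-algebra): ★`holT_gaugeActT` (`(V^u)(Γ) = u(x)·V(Γ)·u(x + disp Γ)⁻¹` on the torus, from the `ℤᵈ` ✓`hol_gaugeAct` through
✓`hol_pull`/✓`pull_gaugeActT`), ★`hasDerivAt_tstairU_gaugeDir` (the stair transporter's response `N(ŷ) − U₀(Γ)N(x_i)U₀(Γ)⁻¹`), ★★★`hasDerivAt_vframeCovU_gaugeDir` (the displayed formula);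
§3 the same along ANY differentiable gauge family `h_t` through `1` with site derivatives `M` (`hasDerivAt_units_inv_of_one`, ★`hasDerivAt_tstairU_gaugeFamily`, ★★★`hasDerivAt_vframeCovU_gaugeFamily`) —
the form the frame TOWER consumes (at level `j+1` the double-bar field moves by a gauge family only tangent to an exponential one).
§4 THE TOWER ((97) `v_{k+1}(y) = v_k(ŷ)·w_k(y)`): `hasDerivAt_frameAccU_zero` (base: no frame at level `0`) and ★★★`hasDerivAt_frameAccU_succ` — if the level-`k` accumulated frames respond as
`N(x̂⁽ᵏ⁾x) − n(x)` then the level-`(k+1)` ones respond as `N(x̂⁽ᵏ⁺¹⁾y) − n′(y)`, `n′(y) = n(ŷ) − |I|⁻¹Σ_i (n(ŷ) − Ad_{Ū₀⁽ᵏ⁾(Γ_{y,i})} n(x_i))` (the block Ad-AVERAGE of `n`: print's averaged gauge parameter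
`Q′(U₀)λ`, [Balaban1985BackgroundPropagators] (3.19)); the level-`k` double bar along `U₀^{g_t}` is EXACTLY `(Ū₀⁽ᵏ⁾)^{h_t}`, `h_t = v_k(t)⁻¹·(g_t ∘ x̂⁽ᵏ⁾)` (✓`dbarCovIterU_eq_gaugeActT_frameAccU`,
✓`emlIterU_gaugeActT`).  Iterating: `d∕dt|₀ frameTwS-frames = N ∘ x̂ − N⁽ᵏ⁾` with `N⁽ᵏ⁾` the `k`-fold Ad-average — whence `QTwS U₀ (G_{U₀}N) = 𝒢̄_{Ū₀}(N⁽ᵏ⁾)` (sequel).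
HONEST SCOPE: at the background only (the knit's chart point `A₁ ≠ 0` needs more — memo §2); no estimate; nothing of print asserted.

References: T. Bałaban, CMP 98 (1985) 17–51 [Balaban1985Averaging] ((8)–(9) p.18, (11) p.19, (58) p.27, (82) p.30, (87) p.31, (97) p.32); CMP 109 (1987) 249–301 [Balaban1987RG1] ((0.4), (0.8) p.253).
-/

set_option autoImplicit false

noncomputable section

open scoped BigOperators Topology
open Filter NormedSpace

namespace Summit.QuantumFields.YangMills.Theorems.Prop7SymFrameGaugeResponse

open Literature.MathematicalPhysics.QuantumFieldTheory.Balaban1983to89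
open T4Continuum BlockAveraging ExpMeanLog MatrixLog
open B10Eq27TorusAxialLog (holT holT_nil gaugeActT gaugeActT_apply pull pull_apply transl transl_zero hol_pull pull_gaugeActT)
open B7Prop1Explicit (expUnit val_expUnit val_inv_expUnit disp hol_gaugeAct)
open Summit.QuantumFields.YangMills.Theorems.Prop7SymAvgTwSym (tstairU tstairU_def vframeCovU coe_vframeCovU tstairU_self)
open BlockAveragingEMLAnalyticMean (hasFDerivAt_eml_one)

variable {P : Params} {𝔸 : Type*} [NormedRing 𝔸] [NormedAlgebra ℂ 𝔸] [CompleteSpace 𝔸] {j : ℕ}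

/-! ## §1 Gauge covariance of parallel transport on the torus, with the end-point -/

/-- ★ **`(V^u)(Γ) = u(x)·V(Γ)·u(x + disp Γ)⁻¹` ON THE TORUS** (any group): [Balaban1985Averaging] (8) along an open contour, the `ℤᵈ` lemma ✓`hol_gaugeAct` read through the
periodic pullback (✓`hol_pull`, ✓`pull_gaugeActT`). [cite: Balaban1985Averaging, (8)-(9) p.18] -/
theorem holT_gaugeActT {G : Type*} [Group G] (u : GaugeTransf P j G) (V : GaugeField P j G) (x : Site P j) (w : List (B7Prop1Explicit.Letter P.d)) :
    holT (gaugeActT u V) x w = u x * holT V x w * (u (transl x (disp w)))⁻¹ := by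
  have h1 : holT (gaugeActT u V) x w = B7Prop1Explicit.hol (pull (gaugeActT u V) x) 0 w := by
    rw [hol_pull, transl_zero]
  have h2 : holT V x w = B7Prop1Explicit.hol (pull V x) 0 w := by
    rw [hol_pull, transl_zero]
  rw [h1, h2, pull_gaugeActT, hol_gaugeAct, zero_add, transl_zero]

/-! ## §2 The stair transporter and the frame along a gauge direction of the field, background fixed -/

/-- ★ **THE TWISTED STAIR TRANSPORTER ALONG A GAUGE DIRECTION**: for `W_t = U₀^{exp(tN)}` (left action at `b₋`, right at `b₊`; `U₀` fixed in the second slot),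
`d∕dt|₀ (W_t(Γ_{y,i})·U₀(Γ_{y,i})⁻¹) = N(ŷ) − U₀(Γ_{y,i})·N(x_i)·U₀(Γ_{y,i})⁻¹`, `x_i = ŷ + disp Γ_{y,i}` the stair's end-point. [cite: Balaban1985Averaging, (8) p.18, (58) p.27] -/
theorem hasDerivAt_tstairU_gaugeDir (U₀ : GaugeField P j 𝔸ˣ) (N : Site P j → 𝔸) (y : Site P (j + 1)) (i : Idx P) :
    HasDerivAt (fun t : ℝ => ((tstairU U₀ (gaugeActT (fun x : Site P j => expUnit (t • N x)) U₀) y i : 𝔸ˣ) : 𝔸))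
      (N (emb y) - ((holT U₀ (emb y) (stairWord i.2.1 (off i.1)) : 𝔸ˣ) : 𝔸) * N (transl (emb y) (disp (stairWord i.2.1 (off i.1)))) *
          (((holT U₀ (emb y) (stairWord i.2.1 (off i.1)))⁻¹ : 𝔸ˣ) : 𝔸)) 0 := by
  -- letters
  set w := stairWord (d := P.d) i.2.1 (off i.1) with hw
  set Pₕ : 𝔸ˣ := holT U₀ (emb y) w with hP
  set x₁ : Site P j := transl (emb y) (disp w) with hx₁
  -- the transporter as an explicit product of exponentials
  have hfun : (fun t : ℝ => ((tstairU U₀ (gaugeActT (fun x : Site P j => expUnit (t • N x)) U₀) y i : 𝔸ˣ) : 𝔸))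
      = fun t : ℝ => exp (t • N (emb y)) * ((Pₕ : 𝔸) * exp (t • (-N x₁)) * ((Pₕ⁻¹ : 𝔸ˣ) : 𝔸)) := by
    funext t
    rw [tstairU_def, holT_gaugeActT, Units.val_mul, Units.val_mul, Units.val_mul, val_inv_expUnit, val_expUnit, val_expUnit, smul_neg]
    simp only [mul_assoc]
    rfl
  rw [hfun]
  -- derivatives of the two exponential factors at `0`
  have hA : HasDerivAt (fun t : ℝ => exp (t • N (emb y))) (N (emb y)) 0 := by
    simpa using hasDerivAt_exp_smul_const' (𝕂 := ℝ) (N (emb y)) 0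
  have hB : HasDerivAt (fun t : ℝ => (Pₕ : 𝔸) * exp (t • (-N x₁)) * ((Pₕ⁻¹ : 𝔸ˣ) : 𝔸)) ((Pₕ : 𝔸) * (-N x₁) * ((Pₕ⁻¹ : 𝔸ˣ) : 𝔸)) 0 := by
    have h := hasDerivAt_exp_smul_const' (𝕂 := ℝ) (-N x₁) 0
    simp only [zero_smul, exp_zero, mul_one] at h
    exact (h.const_mul (Pₕ : 𝔸)).mul_const ((Pₕ⁻¹ : 𝔸ˣ) : 𝔸)
  have h : HasDerivAt (fun t : ℝ => exp (t • N (emb y)) * ((Pₕ : 𝔸) * exp (t • (-N x₁)) * ((Pₕ⁻¹ : 𝔸ˣ) : 𝔸)))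
      (N (emb y) * ((Pₕ : 𝔸) * exp ((0 : ℝ) • (-N x₁)) * ((Pₕ⁻¹ : 𝔸ˣ) : 𝔸)) + exp ((0 : ℝ) • N (emb y)) * ((Pₕ : 𝔸) * (-N x₁) * ((Pₕ⁻¹ : 𝔸ˣ) : 𝔸))) 0 :=
    hA.mul hB
  refine h.congr_deriv ?_
  simp only [zero_smul, exp_zero, mul_one, one_mul, Units.mul_inv, mul_neg, neg_mul]
  rw [sub_eq_add_neg]

/-- ★★★ **THE SYMMETRIC COVARIANT BLOCK FRAME ALONG A GAUGE DIRECTION, AT THE BACKGROUND**: `d∕dt|₀ w_sym(U₀; U₀^{exp(tN)})(y) = |I|⁻¹ Σ_i (N(ŷ) − U₀(Γ_{y,i})·N(x_i)·U₀(Γ_{y,i})⁻¹)` —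
`D(eml)(1)` is the arithmetic mean (✓`hasFDerivAt_eml_one`), every transporter is `1` at `t = 0` (✓`tstairU_self`), and §2's stair response. [cite: Balaban1985Averaging, (82) p.30, (87) p.31; Balaban1987RG1, (0.8) p.253] -/
theorem hasDerivAt_vframeCovU_gaugeDir (U₀ : GaugeField P j 𝔸ˣ) (N : Site P j → 𝔸) (y : Site P (j + 1)) :
    HasDerivAt (fun t : ℝ => ((vframeCovU U₀ (gaugeActT (fun x : Site P j => expUnit (t • N x)) U₀) y : 𝔸ˣ) : 𝔸))
      (B7TransferAnalyticMean.meanCLM (Idx P) 𝔸 fun i : Idx P =>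
        N (emb y) - ((holT U₀ (emb y) (stairWord i.2.1 (off i.1)) : 𝔸ˣ) : 𝔸) * N (transl (emb y) (disp (stairWord i.2.1 (off i.1)))) *
          (((holT U₀ (emb y) (stairWord i.2.1 (off i.1)))⁻¹ : 𝔸ˣ) : 𝔸)) 0 := by
  -- the frame is `eml` of the transporter family
  have hfun : (fun t : ℝ => ((vframeCovU U₀ (gaugeActT (fun x : Site P j => expUnit (t • N x)) U₀) y : 𝔸ˣ) : 𝔸))
      = (eml : (Idx P → 𝔸) → 𝔸) ∘ fun t : ℝ => fun i : Idx P => ((tstairU U₀ (gaugeActT (fun x : Site P j => expUnit (t • N x)) U₀) y i : 𝔸ˣ) : 𝔸) := by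
    funext t; rw [Function.comp_apply, coe_vframeCovU]
  rw [hfun]
  -- the family is `1` at `t = 0`
  have hzero : (fun i : Idx P => ((tstairU U₀ (gaugeActT (fun x : Site P j => expUnit ((0 : ℝ) • N x)) U₀) y i : 𝔸ˣ) : 𝔸)) = 1 := by
    have hg : (fun x : Site P j => expUnit ((0 : ℝ) • N x)) = fun _ => (1 : 𝔸ˣ) := by
      funext x; apply Units.ext; rw [val_expUnit, zero_smul, exp_zero, Units.val_one]
    have hW : gaugeActT (fun _ : Site P j => (1 : 𝔸ˣ)) U₀ = U₀ := by
      funext b; rw [gaugeActT_apply, inv_one, one_mul, mul_one]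
    funext i
    rw [hg, hW, tstairU_self, Units.val_one, Pi.one_apply]
  -- the family is differentiable at `0`, coordinatewise by §2
  have hfam : HasDerivAt (fun t : ℝ => fun i : Idx P => ((tstairU U₀ (gaugeActT (fun x : Site P j => expUnit (t • N x)) U₀) y i : 𝔸ˣ) : 𝔸))
      (fun i : Idx P => N (emb y) - ((holT U₀ (emb y) (stairWord i.2.1 (off i.1)) : 𝔸ˣ) : 𝔸) * N (transl (emb y) (disp (stairWord i.2.1 (off i.1)))) *
          (((holT U₀ (emb y) (stairWord i.2.1 (off i.1)))⁻¹ : 𝔸ˣ) : 𝔸)) 0 :=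
    hasDerivAt_pi.2 fun i => hasDerivAt_tstairU_gaugeDir U₀ N y i
  -- chain rule through `eml` at `1`
  have heml := (hasFDerivAt_eml_one (ι := Idx P) (𝔸 := 𝔸)).restrictScalars ℝ
  exact heml.comp_hasDerivAt_of_eq (0 : ℝ) hfam hzero.symm

/-! ## §3 The same along ANY differentiable gauge family through `1` (the form the frame tower consumes: at level `j+1` the field moves by a gauge family that is only tangent to an exponential one) -/

/-- The inverse of a unit-valued curve through `1`: if `↑(h t)` has derivative `M` at `0` and `h 0 = 1` then `↑(h t)⁻¹` has derivative `−M`. [folklore] -/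
theorem hasDerivAt_units_inv_of_one {h : ℝ → 𝔸ˣ} {M : 𝔸} (h0 : h 0 = 1) (hd : HasDerivAt (fun t : ℝ => ((h t : 𝔸ˣ) : 𝔸)) M 0) :
    HasDerivAt (fun t : ℝ => (((h t)⁻¹ : 𝔸ˣ) : 𝔸)) (-M) 0 := by
  have hinv_eq : (fun t : ℝ => (((h t)⁻¹ : 𝔸ˣ) : 𝔸)) = fun t => Ring.inverse ((h t : 𝔸ˣ) : 𝔸) := by
    funext t; exact (Ring.inverse_unit _).symm
  have h1 : HasFDerivAt (Ring.inverse : 𝔸 → 𝔸) (-ContinuousLinearMap.mulLeftRight ℂ 𝔸 (((h 0)⁻¹ : 𝔸ˣ) : 𝔸) (((h 0)⁻¹ : 𝔸ˣ) : 𝔸)) ((h 0 : 𝔸ˣ) : 𝔸) :=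
    hasFDerivAt_ringInverse (h 0)
  have h2 := (h1.restrictScalars ℝ).comp_hasDerivAt (0 : ℝ) hd
  rw [hinv_eq]
  refine h2.congr_deriv ?_
  rw [h0, inv_one, Units.val_one]
  simp

/-- ★ **THE TWISTED STAIR TRANSPORTER ALONG A GAUGE FAMILY**: `h : ℝ → (sites → 𝔸ˣ)` with `h 0 = 1` and site derivatives `M`; then
`d∕dt|₀ ((U₀^{h_t})(Γ_{y,i})·U₀(Γ_{y,i})⁻¹) = M(ŷ) − U₀(Γ_{y,i})·M(x_i)·U₀(Γ_{y,i})⁻¹`. [cite: Balaban1985Averaging, (8) p.18, (58) p.27] -/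
theorem hasDerivAt_tstairU_gaugeFamily (U₀ : GaugeField P j 𝔸ˣ) {h : ℝ → Site P j → 𝔸ˣ} {M : Site P j → 𝔸} (h0 : h 0 = fun _ => 1)
    (hd : ∀ x, HasDerivAt (fun t : ℝ => ((h t x : 𝔸ˣ) : 𝔸)) (M x) 0) (y : Site P (j + 1)) (i : Idx P) :
    HasDerivAt (fun t : ℝ => ((tstairU U₀ (gaugeActT (h t) U₀) y i : 𝔸ˣ) : 𝔸))
      (M (emb y) - ((holT U₀ (emb y) (stairWord i.2.1 (off i.1)) : 𝔸ˣ) : 𝔸) * M (transl (emb y) (disp (stairWord i.2.1 (off i.1)))) *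
          (((holT U₀ (emb y) (stairWord i.2.1 (off i.1)))⁻¹ : 𝔸ˣ) : 𝔸)) 0 := by
  set w := stairWord (d := P.d) i.2.1 (off i.1) with hw
  set Pₕ : 𝔸ˣ := holT U₀ (emb y) w with hP
  set x₁ : Site P j := transl (emb y) (disp w) with hx₁
  have hfun : (fun t : ℝ => ((tstairU U₀ (gaugeActT (h t) U₀) y i : 𝔸ˣ) : 𝔸))
      = fun t : ℝ => ((h t (emb y) : 𝔸ˣ) : 𝔸) * ((Pₕ : 𝔸) * (((h t x₁)⁻¹ : 𝔸ˣ) : 𝔸) * ((Pₕ⁻¹ : 𝔸ˣ) : 𝔸)) := by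
    funext t
    rw [tstairU_def, holT_gaugeActT, Units.val_mul, Units.val_mul, Units.val_mul]
    simp only [mul_assoc]
    rfl
  rw [hfun]
  have h0y : h 0 (emb y) = 1 := by rw [h0]
  have h0x : h 0 x₁ = 1 := by rw [h0]
  have hA : HasDerivAt (fun t : ℝ => ((h t (emb y) : 𝔸ˣ) : 𝔸)) (M (emb y)) 0 := hd (emb y)
  have hBinv : HasDerivAt (fun t : ℝ => (((h t x₁)⁻¹ : 𝔸ˣ) : 𝔸)) (-M x₁) 0 :=
    hasDerivAt_units_inv_of_one (h := fun t => h t x₁) h0x (hd x₁)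
  have hB : HasDerivAt (fun t : ℝ => (Pₕ : 𝔸) * (((h t x₁)⁻¹ : 𝔸ˣ) : 𝔸) * ((Pₕ⁻¹ : 𝔸ˣ) : 𝔸)) ((Pₕ : 𝔸) * (-M x₁) * ((Pₕ⁻¹ : 𝔸ˣ) : 𝔸)) 0 :=
    (hBinv.const_mul (Pₕ : 𝔸)).mul_const ((Pₕ⁻¹ : 𝔸ˣ) : 𝔸)
  have hprod : HasDerivAt (fun t : ℝ => ((h t (emb y) : 𝔸ˣ) : 𝔸) * ((Pₕ : 𝔸) * (((h t x₁)⁻¹ : 𝔸ˣ) : 𝔸) * ((Pₕ⁻¹ : 𝔸ˣ) : 𝔸)))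
      (M (emb y) * ((Pₕ : 𝔸) * (((h 0 x₁)⁻¹ : 𝔸ˣ) : 𝔸) * ((Pₕ⁻¹ : 𝔸ˣ) : 𝔸)) + ((h 0 (emb y) : 𝔸ˣ) : 𝔸) * ((Pₕ : 𝔸) * (-M x₁) * ((Pₕ⁻¹ : 𝔸ˣ) : 𝔸))) 0 :=
    hA.mul hB
  refine hprod.congr_deriv ?_
  rw [h0y, h0x]
  simp only [inv_one, Units.val_one, mul_one, one_mul, Units.mul_inv, mul_neg, neg_mul]
  rw [sub_eq_add_neg]

/-- ★★★ **THE SYMMETRIC COVARIANT BLOCK FRAME ALONG A GAUGE FAMILY, AT THE BACKGROUND**: for `h : ℝ → (sites → 𝔸ˣ)`, `h 0 = 1`, site derivatives `M`: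
`d∕dt|₀ w_sym(U₀; U₀^{h_t})(y) = |I|⁻¹ Σ_i (M(ŷ) − U₀(Γ_{y,i})·M(x_i)·U₀(Γ_{y,i})⁻¹)`. [cite: Balaban1985Averaging, (82) p.30, (87) p.31; Balaban1987RG1, (0.8) p.253] -/
theorem hasDerivAt_vframeCovU_gaugeFamily (U₀ : GaugeField P j 𝔸ˣ) {h : ℝ → Site P j → 𝔸ˣ} {M : Site P j → 𝔸} (h0 : h 0 = fun _ => 1)
    (hd : ∀ x, HasDerivAt (fun t : ℝ => ((h t x : 𝔸ˣ) : 𝔸)) (M x) 0) (y : Site P (j + 1)) :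
    HasDerivAt (fun t : ℝ => ((vframeCovU U₀ (gaugeActT (h t) U₀) y : 𝔸ˣ) : 𝔸))
      (B7TransferAnalyticMean.meanCLM (Idx P) 𝔸 fun i : Idx P =>
        M (emb y) - ((holT U₀ (emb y) (stairWord i.2.1 (off i.1)) : 𝔸ˣ) : 𝔸) * M (transl (emb y) (disp (stairWord i.2.1 (off i.1)))) *
          (((holT U₀ (emb y) (stairWord i.2.1 (off i.1)))⁻¹ : 𝔸ˣ) : 𝔸)) 0 := by
  have hfun : (fun t : ℝ => ((vframeCovU U₀ (gaugeActT (h t) U₀) y : 𝔸ˣ) : 𝔸))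
      = (eml : (Idx P → 𝔸) → 𝔸) ∘ fun t : ℝ => fun i : Idx P => ((tstairU U₀ (gaugeActT (h t) U₀) y i : 𝔸ˣ) : 𝔸) := by
    funext t; rw [Function.comp_apply, coe_vframeCovU]
  rw [hfun]
  have hzero : (fun i : Idx P => ((tstairU U₀ (gaugeActT (h 0) U₀) y i : 𝔸ˣ) : 𝔸)) = 1 := by
    have hW : gaugeActT (h 0) U₀ = U₀ := by
      funext b; rw [gaugeActT_apply, h0, inv_one, one_mul, mul_one]
    funext i
    rw [hW, tstairU_self, Units.val_one, Pi.one_apply]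
  have hfam : HasDerivAt (fun t : ℝ => fun i : Idx P => ((tstairU U₀ (gaugeActT (h t) U₀) y i : 𝔸ˣ) : 𝔸))
      (fun i : Idx P => M (emb y) - ((holT U₀ (emb y) (stairWord i.2.1 (off i.1)) : 𝔸ˣ) : 𝔸) * M (transl (emb y) (disp (stairWord i.2.1 (off i.1)))) *
          (((holT U₀ (emb y) (stairWord i.2.1 (off i.1)))⁻¹ : 𝔸ˣ) : 𝔸)) 0 :=
    hasDerivAt_pi.2 fun i => hasDerivAt_tstairU_gaugeFamily U₀ h0 hd y i
  have heml := (hasFDerivAt_eml_one (ι := Idx P) (𝔸 := 𝔸)).restrictScalars ℝ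
  exact heml.comp_hasDerivAt_of_eq (0 : ℝ) hfam hzero.symm

/-! ## §4 The accumulated frames (97) along a gauge family: base and inductive step of the tower -/

section Tower

open Summit.QuantumFields.YangMills.Theorems.Prop8Chart (emlIterU emlIterU_gaugeActT)
open Summit.QuantumFields.YangMills.Theorems.Prop7SymAvgTwSym (frameAccU frameAccU_succ frameAccU_zero frameAccU_self dbarCovIterU dbarCovIterU_eq_gaugeActT_frameAccU)
open B15DeterminingSets (embIter)

omit [NormedAlgebra ℂ 𝔸] [CompleteSpace 𝔸] in
/-- composition of gauge transformations (group algebra). [cite: Balaban1985Averaging, (8) p.19] -/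
private theorem gaugeActT_gaugeActT' {k : ℕ} (u v : Site P k → 𝔸ˣ) (V : GaugeField P k 𝔸ˣ) :
    gaugeActT u (gaugeActT v V) = gaugeActT (fun x => u x * v x) V := by
  funext b
  simp only [gaugeActT_apply, mul_inv_rev, mul_assoc]

/-- **BASE OF THE TOWER**: at level `0` there is no frame (`frameAccU 0 = 1`), so its response is `0 = N(x) − N(x)`. [cite: Balaban1985Averaging, (97) p.32] -/
theorem hasDerivAt_frameAccU_zero (U₀ : GaugeField P 0 𝔸ˣ) (g : ℝ → Site P 0 → 𝔸ˣ) (N : Site P 0 → 𝔸) (x : Site P 0) :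
    HasDerivAt (fun t : ℝ => ((frameAccU 0 U₀ (gaugeActT (g t) U₀) x : 𝔸ˣ) : 𝔸)) (N (embIter 0 x) - N x) 0 := by
  have h1 : (fun t : ℝ => ((frameAccU 0 U₀ (gaugeActT (g t) U₀) x : 𝔸ˣ) : 𝔸)) = fun _ => 1 := by
    funext t; rw [frameAccU_zero, Units.val_one]
  rw [h1, show N (embIter 0 x) - N x = 0 from sub_self _]
  exact hasDerivAt_const 0 1

/-- ★★★ **THE INDUCTIVE STEP OF THE FRAME TOWER ALONG A GAUGE FAMILY** ((97): `v_{k+1}(y) = v_k(ŷ)·w_k(y)`).  Let `g : ℝ → (sites → 𝔸ˣ)` be a gauge family through `1` with site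
derivatives `N`, `W_t := U₀^{g_t}`.  If at level `k` the accumulated frames respond as `d∕dt|₀ v_k(W_t)(x) = N(x̂⁽ᵏ⁾x) − n(x)` for some level-`k` parameter `n`, then at level `k+1`
`d∕dt|₀ v_{k+1}(W_t)(y) = N(x̂⁽ᵏ⁺¹⁾y) − n′(y)` with **`n′(y) = n(ŷ) − |I|⁻¹Σ_i (n(ŷ) − Ū₀⁽ᵏ⁾(Γ_{y,i})·n(x_i)·Ū₀⁽ᵏ⁾(Γ_{y,i})⁻¹)`** (`= |I|⁻¹Σ_i Ad_{Ū₀⁽ᵏ⁾(Γ_{y,i})} n(x_i)`, the block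
Ad-average of `n` — print's averaged gauge parameter `Q′(U₀)λ`).  Proof: the level-`k` double-bar field is EXACTLY `(Ū₀⁽ᵏ⁾)^{h_t}` with `h_t = v_k(W_t)⁻¹·(g_t ∘ x̂⁽ᵏ⁾)`
(✓`dbarCovIterU_eq_gaugeActT_frameAccU` + ✓`emlIterU_gaugeActT`), `h_0 = 1`, `ḣ = n`; then §3 (`hasDerivAt_vframeCovU_gaugeFamily`) and the product rule at `v_k(0) = 1`.
[cite: Balaban1985Averaging, (97) p.32, (82) p.30, (11) p.19; Balaban1985BackgroundPropagators, (3.19) p.394] -/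
theorem hasDerivAt_frameAccU_succ (U₀ : GaugeField P 0 𝔸ˣ) {g : ℝ → Site P 0 → 𝔸ˣ} {N : Site P 0 → 𝔸} (hg0 : g 0 = fun _ => 1)
    (hgd : ∀ x, HasDerivAt (fun t : ℝ => ((g t x : 𝔸ˣ) : 𝔸)) (N x) 0) (k : ℕ) {n : Site P k → 𝔸}
    (hF : ∀ x : Site P k, HasDerivAt (fun t : ℝ => ((frameAccU k U₀ (gaugeActT (g t) U₀) x : 𝔸ˣ) : 𝔸)) (N (embIter k x) - n x) 0) (y : Site P (k + 1)) :
    HasDerivAt (fun t : ℝ => ((frameAccU (k + 1) U₀ (gaugeActT (g t) U₀) y : 𝔸ˣ) : 𝔸))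
      (N (embIter (k + 1) y) - (n (emb y) - B7TransferAnalyticMean.meanCLM (Idx P) 𝔸 fun i : Idx P =>
        n (emb y) - ((holT (emlIterU k U₀) (emb y) (stairWord i.2.1 (off i.1)) : 𝔸ˣ) : 𝔸) * n (transl (emb y) (disp (stairWord i.2.1 (off i.1)))) *
          (((holT (emlIterU k U₀) (emb y) (stairWord i.2.1 (off i.1)))⁻¹ : 𝔸ˣ) : 𝔸))) 0 := by
  -- the corrected gauge family at level `k`
  set h : ℝ → Site P k → 𝔸ˣ := fun t x => (frameAccU k U₀ (gaugeActT (g t) U₀) x)⁻¹ * g t (embIter k x) with hh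
  -- the level-`k` double bar is exactly `(Ū₀⁽ᵏ⁾)^{h_t}`
  have hD : ∀ t, dbarCovIterU k U₀ (gaugeActT (g t) U₀) = gaugeActT (h t) (emlIterU k U₀) := by
    intro t
    have hk := emlIterU_gaugeActT (fun i => fun x : Site P i => g t (embIter i x)) (fun i y => rfl) U₀ k
    have hus0 : (fun x : Site P 0 => g t (embIter 0 x)) = g t := rfl
    rw [hus0] at hk
    rw [dbarCovIterU_eq_gaugeActT_frameAccU, hk, gaugeActT_gaugeActT']
  -- `h 0 = 1` and `ḣ = n`
  have hW0 : gaugeActT (g 0) U₀ = U₀ := by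
    funext b; rw [gaugeActT_apply, hg0, inv_one, one_mul, mul_one]
  have hg0e : ∀ x : Site P 0, g 0 x = 1 := fun x => by rw [hg0]
  have hF0 : ∀ x : Site P k, frameAccU k U₀ (gaugeActT (g 0) U₀) x = 1 := fun x => by rw [hW0, frameAccU_self]
  have hh0 : h 0 = fun _ => 1 := by
    funext x
    show (frameAccU k U₀ (gaugeActT (g 0) U₀) x)⁻¹ * g 0 (embIter k x) = 1
    rw [hF0, hg0e, inv_one, one_mul]
  have hhd : ∀ x : Site P k, HasDerivAt (fun t : ℝ => ((h t x : 𝔸ˣ) : 𝔸)) (n x) 0 := by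
    intro x
    have hinv : HasDerivAt (fun t : ℝ => (((frameAccU k U₀ (gaugeActT (g t) U₀) x)⁻¹ : 𝔸ˣ) : 𝔸)) (-(N (embIter k x) - n x)) 0 :=
      hasDerivAt_units_inv_of_one (h := fun t => frameAccU k U₀ (gaugeActT (g t) U₀) x) (hF0 x) (hF x)
    have hprod := hinv.mul (hgd (embIter k x))
    have hfun : (fun t : ℝ => ((h t x : 𝔸ˣ) : 𝔸)) = fun t => (((frameAccU k U₀ (gaugeActT (g t) U₀) x)⁻¹ : 𝔸ˣ) : 𝔸) * ((g t (embIter k x) : 𝔸ˣ) : 𝔸) := by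
      funext t; rw [hh]; simp only [Units.val_mul]
    rw [hfun]
    refine hprod.congr_deriv ?_
    simp only [hg0e, hF0, inv_one, Units.val_one, mul_one, one_mul]
    abel
  -- the one-level frame at level `k` along `h`
  have hv := hasDerivAt_vframeCovU_gaugeFamily (emlIterU k U₀) hh0 hhd y
  -- the accumulated frame: product rule
  have hfunF : (fun t : ℝ => ((frameAccU (k + 1) U₀ (gaugeActT (g t) U₀) y : 𝔸ˣ) : 𝔸))
      = fun t => ((frameAccU k U₀ (gaugeActT (g t) U₀) (emb y) : 𝔸ˣ) : 𝔸) * ((vframeCovU (emlIterU k U₀) (gaugeActT (h t) (emlIterU k U₀)) y : 𝔸ˣ) : 𝔸) := by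
    funext t; rw [frameAccU_succ, Units.val_mul, hD t]
  rw [hfunF]
  have hprod := (hF (emb y)).mul hv
  refine hprod.congr_deriv ?_
  have hv0 : ((vframeCovU (emlIterU k U₀) (gaugeActT (h 0) (emlIterU k U₀)) y : 𝔸ˣ) : 𝔸) = 1 := by
    rw [hh0]
    have : gaugeActT (fun _ : Site P k => (1 : 𝔸ˣ)) (emlIterU k U₀) = emlIterU k U₀ := by
      funext b; rw [gaugeActT_apply, inv_one, one_mul, mul_one]
    rw [this, Prop7SymAvgTwSym.vframeCovU_self, Units.val_one]
  rw [hv0, hF0, Units.val_one, mul_one, one_mul]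
  show N (embIter k (emb y)) - n (emb y) + _ = N (embIter k (emb y)) - _
  abel

end Tower

end Summit.QuantumFields.YangMills.Theorems.Prop7SymFrameGaugeResponse

end
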